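import Summits.BirchSwinnertonDyer.BirchSwinnertonDyer.Theorems.PrintCf2RubinValueTwoRowTwoTwistedKummerClass
import Literature.NumberTheory.GaloisRepresentations.CorestrictionTransferComparison
import Literature.GroupTheory.ProfiniteSubquotients
import Mathlib.Tactic.Group
import HarnessLib

/-!
# M-LINE-PIN / (α3) ROW 2, FILE 3e: the CORESTRICTION LAW of the twisted Kummer classes —
# `cor_{U/U'} κ_{U'}(β) = κ_U(∏ₓ s(x)·β)` where `θ` is trivial on `U`

Cell `bsd-print-cf2`, WIDTH seat `bsd-line-cf2-p1-w6` g8 (prover-bsd-line-cf2-p1-w6-g8-0); (α3) ROW 2 on the DECIDING child stmt-BirchSwinnertonDyer-24721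
(memo `HOME/bsd-line-cf2-p1-w6/ROW2-SPEC-w6g8.md`; hypothesis `hredn` of `RowTwo.proj_lift_sub_lift_mem` — "`cor ∘ Kummer = Kummer ∘ Norm`"
between the fields `K_θ K̃_{n+1} ⊃ K_θ K̃_n`, on both of which `θ` is trivial); `--supports` that item (helper, Theses-free).
HONEST FRAMING: cohomological bookkeeping (Neukirch–Schmidt–Wingberg I §5 in ty2's `G_S`-currency); nothing about BSD. THEOREMS ONLY.

* `exists_quotientEquiv_imGS` — for `N_S ≤ U' ≤ U ≤ Γ_K` the projection `Γ_K ↠ G_S` induces a bijection `U/U' ≃ U_S/U'_S`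
  compatible with the projection of representatives.
* `isTwistedKummerClass_relCores` — for `U' ≤ U` open, `N_S ≤ U'`, `θ|_U = 1`, a system `s` of representatives of `U/U'` and a
  twisted Kummer class `c` of `β` at level `U'`: ty2's `relCores … k 1 c` (`= cor ∘ toSubgroupOf`, Serre I §2.5, in degree one the
  transfer `cores`, `cores_eq_cor`) is a twisted Kummer class of `∏ₓ s(x)·β` at level `U` (the tree's `p^k`-th root of the norm:
  `KummerCorestrictionNorm.prod_smul_pow`, `RowTwo.prod_smul_eq_normOver`).

References: J. Neukirch, A. Schmidt, K. Wingberg (2008) I §5; J.-P. Serre, *Galois Cohomology* I §2.5; J. Johnson-Leung, G. Kings (2011) Def. 3.5.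
-/

noncomputable section

-- the summit namespace `Summit.BirchSwinnertonDyer.BirchSwinnertonDyer` repeats the problem name by design (D-0017)
set_option linter.dupNamespace false
set_option autoImplicit false

open scoped NumberField
open Field IsDedekindDomain
open Literature.NumberTheory.GaloisRepresentations Literature.NumberTheory.GaloisRepresentations.DiscreteGaloisModule
open Literature.NumberTheory.ComplexMultiplication.EllipticUnits.JohnsonLeungKings2011
open Literature.NumberTheory.EllipticCurves (schreierElt schreierElt_mem schreierElt_coe)

namespace Summit.BirchSwinnertonDyer.BirchSwinnertonDyer.Theorems.PrintCf2.RowTwo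

variable {K : Type} [Field K] [NumberField K] (p : ℕ) [Fact p.Prime] (S : Set (HeightOneSpectrum (𝓞 K)))
  (θ : absoluteGaloisGroup K →ₜ* ℤ_[p]ˣ) (k : ℕ)

omit [NumberField K] in
/-- `muVal` of a finite sum is the product of the `muVal`s. [folklore] -/
private theorem muVal_finset_sum {n : ℕ} {ι : Type*} (t : Finset ι) (v : ι → MuCarrier K n) :
    muVal K n (∑ i ∈ t, v i) = ∏ i ∈ t, muVal K n (v i) := by
  classical
  induction t using Finset.induction_on with
  | empty => simp
  | insert a t ha ih => rw [Finset.sum_insert ha, Finset.prod_insert ha, muVal_add, ih]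

omit [NumberField K] in
/-- **`U/U' ≃ U_S/U'_S`** for `N_S ≤ U' ≤ U ≤ Γ_K`: the projection `Γ_K ↠ G_S = Γ_K/N_S` induces a bijection of left-coset spaces
compatible with the images of elements (injective because `N_S ≤ U'`, surjective because `U ↠ U_S`).
[cite: NeukirchSchmidtWingberg2008, I §5 (cor via coset representatives)] -/
theorem exists_quotientEquiv_imGS {U U' : Subgroup (absoluteGaloisGroup K)} (hN : ramificationSubgroup K S ≤ U') :
    ∃ e : U ⧸ U'.subgroupOf U ≃ ↥(imGS S U) ⧸ (imGS S U').subgroupOf (imGS S U),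
      ∀ a : U, e (a : U ⧸ U'.subgroupOf U) =
        ((⟨toUnramifiedQuot K S a, Subgroup.mem_map_of_mem _ a.2⟩ : imGS S U) :
          ↥(imGS S U) ⧸ (imGS S U').subgroupOf (imGS S U)) := by
  let F : U → imGS S U := fun a ↦ ⟨toUnramifiedQuot K S a, Subgroup.mem_map_of_mem _ a.2⟩
  have hF : ∀ a b : U, (a : U ⧸ U'.subgroupOf U) = b ↔
      (F a : ↥(imGS S U) ⧸ (imGS S U').subgroupOf (imGS S U)) = F b := by
    intro a b
    rw [QuotientGroup.eq, QuotientGroup.eq, Subgroup.mem_subgroupOf, Subgroup.mem_subgroupOf]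
    change ((a : absoluteGaloisGroup K)⁻¹ * b) ∈ U' ↔
      (toUnramifiedQuot K S a)⁻¹ * toUnramifiedQuot K S b ∈ imGS S U'
    rw [← map_inv, ← map_mul]
    refine ⟨fun hab ↦ Subgroup.mem_map_of_mem _ hab, fun hab ↦ ?_⟩
    obtain ⟨u, hu, hu'⟩ := Subgroup.mem_map.mp hab
    have hq : u⁻¹ * ((a : absoluteGaloisGroup K)⁻¹ * b) ∈ ramificationSubgroup K S := QuotientGroup.eq.mp hu'
    have := U'.mul_mem hu (hN hq)
    rwa [mul_inv_cancel_left] at this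
  refine ⟨Equiv.ofBijective
    (Quotient.lift (fun a : U ↦ (F a : ↥(imGS S U) ⧸ (imGS S U').subgroupOf (imGS S U)))
      (fun a b hab ↦ (hF a b).mp (QuotientGroup.eq.mpr (QuotientGroup.leftRel_apply.mp hab))))
    ⟨fun x y ↦ ?_, fun z ↦ ?_⟩, fun a ↦ rfl⟩
  · induction x using QuotientGroup.induction_on with | H a => ?_
    induction y using QuotientGroup.induction_on with | H b => ?_
    exact (hF a b).mpr
  · induction z using QuotientGroup.induction_on with | H w => ?_
    obtain ⟨u, hu, huw⟩ := Subgroup.mem_map.mp w.2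
    refine ⟨((⟨u, hu⟩ : U) : U ⧸ U'.subgroupOf U), ?_⟩
    change (F ⟨u, hu⟩ : ↥(imGS S U) ⧸ (imGS S U').subgroupOf (imGS S U)) = w
    rw [show F ⟨u, hu⟩ = w from Subtype.ext huw]

/-- **Corestriction law** ("`cor ∘ Kummer = Kummer ∘ Norm`", JLK Def. 3.5 `tr_{K(𝔪)/F}` on `κ(u) ⊗ t`; NSW I §5 in degree one): for open
`U' ≤ U ≤ Γ_K` with `N_S ≤ U'` and `θ` trivial on `U`, a system `s` of representatives of `U/U'`, and a twisted Kummer class `c` of `β` at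
level `U'`, ty2's relative corestriction `relCores … k 1 c` is a twisted Kummer class of `∏ₓ s(x)·β` at level `U`
(`relCores = cor ∘ toSubgroupOf`; `cor = cores` in degree one (`cores_eq_cor`); the transfer cocycle of `h ↦ hβ/β` takes the value
`σ(∏ₓ s(x)β)/∏ₓ s(x)β` at `σ`, the twist being invisible because `θ|_U = 1`).
[cite: NeukirchSchmidtWingberg2008, I §5 (corestriction on inhomogeneous cochains)] [cite: JohnsonLeungKings2011, Def. 3.5 (arXiv p0010:L72–80)] -/
theorem isTwistedKummerClass_relCores {U U' : Subgroup (absoluteGaloisGroup K)} (h : U' ≤ U)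
    (hU : IsOpen (U : Set (absoluteGaloisGroup K))) (hU' : IsOpen (U' : Set (absoluteGaloisGroup K)))
    (hN : ramificationSubgroup K S ≤ U') (hθU : ∀ σ ∈ U, θ σ = 1)
    [Fintype (U ⧸ U'.subgroupOf U)] {s : U ⧸ U'.subgroupOf U → U} (hs : ∀ x, (s x : U ⧸ U'.subgroupOf U) = x)
    {β : (AlgebraicClosure K)ˣ} {c : levelCoh p S θ U' k 1} (hc : IsTwistedKummerClass p θ S U' k β c) :
    IsTwistedKummerClass p θ S U k (∏ x, ((s x : U) : absoluteGaloisGroup K) • β) (relCores p S θ h hU hU' k 1 c) := by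
  classical
  -- the instances under which `relCores` is `cor ∘ toSubgroupOf` (as in its definition)
  haveI : TotallyDisconnectedSpace (GaloisGroupUnramifiedOutside K S) :=
    Literature.GroupTheory.ProfiniteSubquotients.totallyDisconnectedSpace_quotient
      (ramificationSubgroup K S) (ramificationSubgroup_isClosed K S)
  have hcU : IsClosed (imGS S U : Set (GaloisGroupUnramifiedOutside K S)) :=
    Subgroup.isClosed_of_isOpen _ (isOpenMap_toUnramifiedQuot K S _ hU)
  have hcU' : IsClosed (imGS S U' : Set (GaloisGroupUnramifiedOutside K S)) :=
    Subgroup.isClosed_of_isOpen _ (isOpenMap_toUnramifiedQuot K S _ hU')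
  haveI : CompactSpace (imGS S U) := isCompact_iff_compactSpace.mp hcU.isCompact
  haveI hNc : IsClosed ((((imGS S U').subgroupOf (imGS S U) : Subgroup (imGS S U))) : Set (imGS S U)) :=
    hcU'.preimage continuous_subtype_val
  haveI : (imGS S U').FiniteIndex := by
    haveI : DiscreteTopology (GaloisGroupUnramifiedOutside K S ⧸ imGS S U') :=
      QuotientGroup.discreteTopology (isOpenMap_toUnramifiedQuot K S _ hU')
    haveI : Finite (GaloisGroupUnramifiedOutside K S ⧸ imGS S U') := finite_of_compact_of_discrete
    exact Subgroup.finiteIndex_of_finite_quotient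
  haveI : ((imGS S U').subgroupOf (imGS S U)).FiniteIndex := inferInstance
  letI : Fintype (↥(imGS S U) ⧸ (imGS S U').subgroupOf (imGS S U)) := Fintype.ofFinite _
  have hNo : IsOpen ((((imGS S U').subgroupOf (imGS S U) : Subgroup (imGS S U))) : Set (imGS S U)) :=
    (isOpenMap_toUnramifiedQuot K S _ hU').preimage continuous_subtype_val
  -- representatives of `U_S/U'_S` read off `s` through `U/U' ≃ U_S/U'_S`
  obtain ⟨e, he⟩ := exists_quotientEquiv_imGS S (U := U) hN
  let F : U → imGS S U := fun a ↦ ⟨toUnramifiedQuot K S a, Subgroup.mem_map_of_mem _ a.2⟩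
  have hFmul : ∀ a b : U, F (a * b) = F a * F b := fun a b ↦ Subtype.ext (map_mul _ _ _)
  have he' : ∀ (a : U) (y : U ⧸ U'.subgroupOf U), e (a • y) = F a • e y := by
    intro a y
    induction y using QuotientGroup.induction_on with | H b => ?_
    rw [MulAction.Quotient.smul_coe, he, he, MulAction.Quotient.smul_coe]
    exact congrArg _ (hFmul a b)
  let t : ↥(imGS S U) ⧸ (imGS S U').subgroupOf (imGS S U) → imGS S U := fun z ↦ F (s (e.symm z))
  have ht : ∀ z, (t z : ↥(imGS S U) ⧸ (imGS S U').subgroupOf (imGS S U)) = z := fun z ↦ by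
    change ((F (s (e.symm z))) : ↥(imGS S U) ⧸ (imGS S U').subgroupOf (imGS S U)) = z
    rw [← he, hs, Equiv.apply_symm_apply]
  -- the cocycle
  obtain ⟨φ₀, rfl, hφ⟩ := hc
  let X := (coeffGS p S θ k).toTopRep
  let N : Subgroup (imGS S U) := (imGS S U').subgroupOf (imGS S U)
  have hle : imGS S U' ≤ imGS S U := Subgroup.map_mono h
  let φ : contOneCocycles (subgroupRep X (imGS S U')) := φ₀
  let ψ : contOneCocycles (subgroupRep (subgroupRep X (imGS S U)) N) :=
    contOneCocycles.pullback (subgroupOfHom hle) (Y := subgroupRep (subgroupRep X (imGS S U)) N)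
      (TopRep.ofHom ⟨ContinuousLinearMap.id ℤ X, fun _ => rfl⟩) φ
  refine ⟨transferCocycle (subgroupRep X (imGS S U)) N hNo ht ψ, ?_, fun σ hσ ↦ ?_⟩
  · -- `relCores [φ] = cor (toSubgroupOf [φ]) = cores [ψ] = [transfer ψ]`
    symm
    change (cor N (levelRep p S θ U k) 1) ((toSubgroupOf X hle 1) (oneCocycleClass _ φ)) = _
    rw [toSubgroupOf, map_oneCocycleClass, ← cores_eq_cor N (levelRep p S θ U k) hNo]
    exact cores_oneCocycleClass _ N hNo ht ψ
  · -- values: `∏_z s̃(σz)·((s̃(σz)⁻¹ σ s̃(z))β/β) = σ(∏ s(y)β)/∏ s(y)β`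
    set σU : U := ⟨σ, hσ⟩ with hσU
    have hg : (⟨toUnramifiedQuot K S σ, Subgroup.mem_map_of_mem _ hσ⟩ : imGS S U) = F σU := rfl
    rw [hg, transferCocycle_apply, transferFun_apply, Submodule.coe_sum, muVal_finset_sum]
    -- per-term computation
    have key : ∀ z : ↥(imGS S U) ⧸ N,
        muVal K (p ^ k) (((subgroupRep X (imGS S U)).ρ (t (F σU • z)) (ψ.1 (schreierElt N ht (F σU) z)) :
            Representation.invariants ((muTwist p θ k).toRepresentation.comp (ramificationSubgroup K S).subtype)) :
          MuCarrier K (p ^ k)) =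
          (σ * (s (e.symm z) : absoluteGaloisGroup K)) • β / ((s (σU • e.symm z) : U) : absoluteGaloisGroup K) • β := by
      intro z
      have hz : e.symm (F σU • z) = σU • e.symm z := by
        apply e.injective; rw [Equiv.apply_symm_apply, he', Equiv.apply_symm_apply]
      -- the Schreier element, read in `Γ_K`
      have hτ : (((s (σU • e.symm z))⁻¹ * σU * s (e.symm z) : U) : absoluteGaloisGroup K) ∈ U' :=
        Subgroup.mem_subgroupOf.mp (schreierElt_mem (U'.subgroupOf U) hs σU (e.symm z))
      have hsch : subgroupOfHom hle (schreierElt N ht (F σU) z) =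
          ⟨toUnramifiedQuot K S (((s (σU • e.symm z))⁻¹ * σU * s (e.symm z) : U) : absoluteGaloisGroup K),
            Subgroup.mem_map_of_mem _ hτ⟩ := by
        apply Subtype.ext
        rw [subgroupOfHom_apply_coe, schreierElt_coe]
        change ((F (s (e.symm (F σU • z))))⁻¹ * F σU * F (s (e.symm z)) : GaloisGroupUnramifiedOutside K S) =
          toUnramifiedQuot K S (((s (σU • e.symm z))⁻¹ * σU * s (e.symm z) : U) : absoluteGaloisGroup K)
        rw [hz]
        simp only [Subgroup.coe_mul, Subgroup.coe_inv, map_mul, map_inv]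
        rfl
      have hθ : θ ((s (σU • e.symm z) : U) : absoluteGaloisGroup K) = 1 := hθU _ (s (σU • e.symm z)).2
      change muVal K (p ^ k) (muTwist p θ k ((s (e.symm (F σU • z)) : U) : absoluteGaloisGroup K)
        (((φ.1 (subgroupOfHom hle (schreierElt N ht (F σU) z)) :
            Representation.invariants ((muTwist p θ k).toRepresentation.comp (ramificationSubgroup K S).subtype)) :
          MuCarrier K (p ^ k)))) = _
      rw [hz, muTwist_apply_of_apply_eq_one p θ k hθ, muVal_apply, hsch, hφ _ hτ, smul_div', ← mul_smul,
        Subgroup.coe_mul, Subgroup.coe_mul, Subgroup.coe_inv, mul_assoc, mul_inv_cancel_left]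
    rw [Finset.prod_congr rfl fun z _ ↦ key z, Finset.prod_div_distrib]
    -- reindex along `e` and along `y ↦ σ • y`
    rw [show (∏ z : ↥(imGS S U) ⧸ N, (σ * (s (e.symm z) : absoluteGaloisGroup K)) • β) =
          ∏ y : U ⧸ U'.subgroupOf U, (σ * (s y : absoluteGaloisGroup K)) • β from
        Equiv.prod_comp e.symm (fun y ↦ (σ * (s y : absoluteGaloisGroup K)) • β),
      show (∏ z : ↥(imGS S U) ⧸ N, ((s (σU • e.symm z) : U) : absoluteGaloisGroup K) • β) =
          ∏ y : U ⧸ U'.subgroupOf U, ((s (σU • y) : U) : absoluteGaloisGroup K) • β from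
        Equiv.prod_comp e.symm (fun y ↦ ((s (σU • y) : U) : absoluteGaloisGroup K) • β),
      show (∏ y : U ⧸ U'.subgroupOf U, ((s (σU • y) : U) : absoluteGaloisGroup K) • β) =
          ∏ y : U ⧸ U'.subgroupOf U, ((s y : U) : absoluteGaloisGroup K) • β from
        Equiv.prod_comp (MulAction.toPerm σU) (fun y ↦ ((s y : U) : absoluteGaloisGroup K) • β),
      Finset.smul_prod']
    congr 1

end Summit.BirchSwinnertonDyer.BirchSwinnertonDyer.Theorems.PrintCf2.RowTwo

end
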